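import Summits.FinalStateConjecture.FinalStateConjecture.Theorems.EIHFluxBalanceModulatedKerrHandoffTameDefs
import Summits.FinalStateConjecture.FinalStateConjecture.Theorems.EIHFluxBalanceModulatedKerrHandoffStubRayTransport
import Summits.FinalStateConjecture.FinalStateConjecture.Theorems.EIHFluxBalanceModulatedKerrHandoffStubRaysStayInClosureTransport
import Summits.FinalStateConjecture.FinalStateConjecture.Theorems.EIHFluxBalanceModulatedKerrHandoffStubCniTransport
import Summits.FinalStateConjecture.FinalStateConjecture.Theorems.EIHFluxBalanceModulatedKerrHandoffStubHandoffAnsatzTransport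
import Literature.Geometry.Lorentzian.MGHDUniqueness
import HarnessLib

/-!
# `EIHFluxBalance.ModulatedKerrHandoff` (item stmt-FinalStateConjecture-17402, H′ — the TAME re-type):
# the `∃ MGHD ∧ ∀ MGHD` bundling of the handoff property is free — ONE maximal development suffices

Line `Sketch` (tame template; skeleton `Cruxes/ModulatedKerrHandoff/Lines/Sketch.lean`), lead prover
`prover-line-stmt-FinalStateConjecture-17402-0`, 2026-08-17 (cycle 2 of the line: reshaping the open core).

The per-datum property of the crux is `HandoffPropT X D = (∃ MGHD) ∧ ∀ MGHD 𝒟, HandoffClause X D 𝒟`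
(`…TameDefs.lean`). Any two maximal vacuum Cauchy developments of `D` are isometric as developments
(`mghd_unique_cauchy`, `MGHDUniqueness.lean`: a time-orientation preserving isometric diffeomorphism `ψ`
with `ψ ∘ ι₁ = ι₂`), and every one of the 17 development-level clauses is transported along such `ψ`
(landed stubs of the line: `stub_rayTransport` — normalised null rays correspond —, hence
`stub_raysStayInClosure_transport` (clause (R)) and `stub_cni_transport` (complete `𝓘⁺`), and
`stub_handoffAnsatz_transport` (the 16-clause ansatz: same moduli, lab chart `ψ ∘ Φ`, exterior `ψ '' O`)).
Hence:

* `handoffClause_of_isIsometricTo` — the handoff clause passes along `IsIsometricTo`;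
* `handoffPropT_iff_exists` — `HandoffPropT X D ↔ ∃ 𝒟 maximal, HandoffClause X D 𝒟`: whoever proves
  the handoff property of a datum may construct ONE maximal development and verify the clauses there.

References: Y. Choquet-Bruhat, R. Geroch, CMP 14 (1969), Thm. 3; H. Ringström, *The Cauchy Problem in
General Relativity* (2009), Thm. 16.6; B. O'Neill, *Semi-Riemannian Geometry* (1983), Ch. 3 pp. 90–91.
-/

set_option linter.dupNamespace false

noncomputable section

namespace Summit.FinalStateConjecture.FinalStateConjecture.Theorems.EIHFluxBalance.TameTemplate

open scoped Topology Manifold ContDiff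
open Filter Set Function TopologicalSpace Literature.Geometry.Lorentzian InitialDataSet

variable {X : Type} [TopologicalSpace X] [ChartedSpace E3 X] [IsManifold (𝓡 3) ((⊤ : ℕ∞) : WithTop ℕ∞) X] [T2Space X] [SecondCountableTopology X] [ConnectedSpace X] {D : InitialDataSet (𝓡 3) X}

/-- **The handoff clause is transported along a time-orientation preserving isometric diffeomorphism
commuting with the data embeddings** (complete `𝓘⁺` by `stub_cni_transport`, the ansatz by
`stub_handoffAnsatz_transport`, both fed with the ray correspondence `stub_rayTransport` /
`stub_raysStayInClosure_transport`). [cite: Ringstrom2009, Thm. 16.6] -/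
theorem handoffClause_transport (𝒟₁ 𝒟₂ : VacuumCauchyDevelopment D)
    (ψ : Diffeomorph (𝓡 4) (𝓡 4) 𝒟₁.carrier 𝒟₂.carrier ((⊤ : ℕ∞) : WithTop ℕ∞))
    (hiso : 𝒟₁.metric.IsIsometry 𝒟₂.metric.toPseudoRiemannianMetric ψ)
    (hτ : 𝒟₁.timeOrientation.PreservesTimeOrientation ψ 𝒟₂.timeOrientation)
    (hι : ψ ∘ 𝒟₁.embed = 𝒟₂.embed) (h : HandoffClause X D 𝒟₁) : HandoffClause X D 𝒟₂ := by
  have hR := stub_raysStayInClosure_transport X D 𝒟₁ 𝒟₂ ψ hiso hτ hι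
    (@stub_rayTransport X _ _ _ _ _ _ D 𝒟₁ 𝒟₂ ψ hiso hτ hι)
  rw [handoffClause_iff] at h ⊢
  exact ⟨stub_cni_transport X D 𝒟₁ 𝒟₂ ψ hiso hτ hι
      (@stub_rayTransport X _ _ _ _ _ _ D 𝒟₁ 𝒟₂ ψ hiso hτ hι) h.1,
    stub_handoffAnsatz_transport X D 𝒟₁ 𝒟₂ ψ hiso hτ hι hR h.2⟩

/-- **The handoff clause passes between isometric developments.** [cite: Ringstrom2009, Thm. 16.6] -/
theorem handoffClause_of_isIsometricTo {𝒟₁ 𝒟₂ : VacuumCauchyDevelopment D}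
    (h : 𝒟₁.toCauchyDevelopment.IsIsometricTo 𝒟₂.toCauchyDevelopment) (h₁ : HandoffClause X D 𝒟₁) :
    HandoffClause X D 𝒟₂ := by
  obtain ⟨ψ, hiso, hτ, hι⟩ := h
  exact handoffClause_transport 𝒟₁ 𝒟₂ ψ hiso hτ hι h₁

/-- **ONE MAXIMAL DEVELOPMENT SUFFICES**: the handoff property of a datum — an MGHD exists and EVERY
MGHD has complete `𝓘⁺` and the modulated ansatz with handoff — is equivalent to the existence of ONE
maximal vacuum Cauchy development with the handoff clause (MGHD uniqueness up to isometry,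
`mghd_unique_cauchy`, plus `handoffClause_of_isIsometricTo`). Registered anchor of this file
(closed `∀`-form). [cite: Ringstrom2009, Thm. 16.6] -/
theorem handoffPropT_iff_exists :
    ∀ (X : Type) [TopologicalSpace X] [ChartedSpace E3 X] [IsManifold (𝓡 3) ((⊤ : ℕ∞) : WithTop ℕ∞) X] [T2Space X] [SecondCountableTopology X] [ConnectedSpace X] (D : InitialDataSet (𝓡 3) X), HandoffPropT X D ↔ ∃ 𝒟 : VacuumCauchyDevelopment D, 𝒟.IsMaximal ∧ HandoffClause X D 𝒟 := by
  intro X _ _ _ _ _ _ D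
  constructor
  · rintro ⟨⟨𝒟, h𝒟⟩, hall⟩
    exact ⟨𝒟, h𝒟, hall 𝒟 h𝒟⟩
  · rintro ⟨𝒟, h𝒟, hcl⟩
    exact ⟨⟨𝒟, h𝒟⟩, fun 𝒟' h𝒟' ↦ handoffClause_of_isIsometricTo (mghd_unique_cauchy 𝒟 𝒟' h𝒟 h𝒟') hcl⟩

end Summit.FinalStateConjecture.FinalStateConjecture.Theorems.EIHFluxBalance.TameTemplate

end
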